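import Summits.Ventures.Crystal3D.Theorems.StickyWulffConstantTextureBuildCellOfColumns
import Summits.Ventures.Crystal3D.Theorems.StickyWulffConstantTextureBuildColumnClean
import Summits.Ventures.Crystal3D.Theorems.StickyWulffConstantTextureBuildHealLabelled
import HarnessLib

/-!
# TB-1 brick S5(c), integrated: THE WALL CELL OF TWO DESCENTS — from the two certified presentations (descent conclusions) and a placement whose plate slabs lie in
# the certified cylinders, the `PlacedCell` with all mesh identities
# (lane T, crux `TextureLiminfV5`, stmt-Ventures-23912; memo HOME/wulff-p2/g25/TB-COVER-BLUEPRINT-v2.md A4–A6)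

HONEST FRAMING. Venture `Summits/Ventures/Crystal3D` (cell `crystal3d-full`), route `route-Ventures-StickyWulffConstant`, helper `--supports` the
law-v5 crux `TextureLiminfV5` (stmt-Ventures-23912).  Composition (census-free, standard axioms) of `column_clean` ('…ColumnClean') with
`exists_placedCell_of_windows_pres` ('…CellOfColumns').  No wall law is proved; F-C1 not moved.

WHY.  Integration test of the near-wall kit: the conclusion shape of the descents (`exists_frame_descent` / `descentPropagation_shell` in the witness-free case: «every
site of `stacking L_f b_f s_f` on the levels `0 … K_f+1` below `b_f` with ℓ¹-index `≤ N_f M` is a ball», likewise for `g`) and ONE geometric hypothesis (the two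
model plate slabs of the placement `p ↦ M p + t` lie inside the certified frame cylinders) give the wall cell with the `Mesh.hS₁/hS₂`, `Mesh₄.hpres`, `Mesh.hlaw` and
`hfull` identities — no healing needed on clean columns.

* **`exists_placedCell_of_descents`** — the statement above.
-/

noncomputable section

open scoped BigOperators InnerProductSpace

namespace Summit.Ventures.Crystal3D.Cruxes.TextureLiminf.TexShadow

open Summit.Ventures.Crystal3D Summit.Ventures.Crystal3D.Theorems
open Literature.MathematicalPhysics.StatisticalMechanics (IsHaggSeq barlowPos)

variable {N₀ : ℕ} {x : Fin N₀ → E3}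

/-- **THE WALL CELL OF TWO DESCENTS.**  See the module docstring. -/
theorem exists_placedCell_of_descents (hx : IsUnitPacking x) (C R₀ : ℝ) (hR₀ : 0 < R₀) {h ρ : ℝ} (hh : 0 ≤ h) (hρ : R₀ ≤ ρ)
    -- side `f` (below): a presentation certified on the levels `0 … K_f + 1` below `b_f`
    {L_f : E3 ≃ₗᵢ[ℝ] E3} {b_f : E3} {s_f : ℤ → ℤ} (hs_f : IsHaggSeq s_f) (K_f : ℕ) (N_f : ℕ → ℤ) {ρ_f : ℝ} (hρ_f : 1 ≤ ρ_f)
    (hN_f : ∀ M : ℕ, M ≤ K_f + 1 → 4 * ρ_f + ((K_f : ℝ) + 1) ≤ ((N_f M : ℤ) : ℝ))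
    (hocc_f : ∀ M : ℕ, M ≤ K_f + 1 → ∀ i j : ℤ, |i| + |j| ≤ N_f M → L_f (barlowPos 1 (Real.sqrt (2 / 3)) s_f (-(M : ℤ)) i j) + b_f ∈ Set.range x)
    -- side `g` (above): likewise
    {L_g : E3 ≃ₗᵢ[ℝ] E3} {b_g : E3} {s_g : ℤ → ℤ} (hs_g : IsHaggSeq s_g) (K_g : ℕ) (N_g : ℕ → ℤ) {ρ_g : ℝ} (hρ_g : 1 ≤ ρ_g)
    (hN_g : ∀ M : ℕ, M ≤ K_g + 1 → 4 * ρ_g + ((K_g : ℝ) + 1) ≤ ((N_g M : ℤ) : ℝ))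
    (hocc_g : ∀ M : ℕ, M ≤ K_g + 1 → ∀ i j : ℤ, |i| + |j| ≤ N_g M → L_g (barlowPos 1 (Real.sqrt (2 / 3)) s_g (-(M : ℤ)) i j) + b_g ∈ Set.range x)
    -- the placement and the containment of its two plate slabs in the certified cylinders
    (M : E3 ≃ₗᵢ[ℝ] E3) (t : E3)
    (hin_f : ∀ w : E3, -(2 * R₀) ≤ (M.symm (w - t)) 2 → (M.symm (w - t)) 2 ≤ -R₀ → (M.symm (w - t)) 0 ^ 2 + (M.symm (w - t)) 1 ^ 2 ≤ ρ ^ 2 →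
      -(((K_f : ℝ) + 1) * Real.sqrt (2 / 3)) ≤ (L_f.symm (w - b_f)) 2 ∧ (L_f.symm (w - b_f)) 2 ≤ 0 ∧
        (L_f.symm (w - b_f)) 0 ^ 2 + (L_f.symm (w - b_f)) 1 ^ 2 ≤ ρ_f ^ 2)
    (hin_g : ∀ w : E3, h + R₀ ≤ (M.symm (w - t)) 2 → (M.symm (w - t)) 2 ≤ h + 2 * R₀ → (M.symm (w - t)) 0 ^ 2 + (M.symm (w - t)) 1 ^ 2 ≤ ρ ^ 2 →
      -(((K_g : ℝ) + 1) * Real.sqrt (2 / 3)) ≤ (L_g.symm (w - b_g)) 2 ∧ (L_g.symm (w - b_g)) 2 ≤ 0 ∧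
        (L_g.symm (w - b_g)) 0 ^ 2 + (L_g.symm (w - b_g)) 1 ^ 2 ≤ ρ_g ^ 2) :
    ∃ pc : PlacedCell C R₀ (Finset.univ.image x), pc.M = M ∧ pc.t = t ∧ pc.h = h ∧ pc.ρ = ρ ∧
      ((∀ r : E3, rigid M t (pc.L₁ r + pc.s₁) = L_f r + b_f) ∧ pc.σ₁ = s_f) ∧
      ((∀ r : E3, rigid M t (pc.L₂ r + pc.s₂) = L_g r + b_g) ∧ pc.σ₂ = s_g) ∧
      rigid M t '' stacking pc.L₁ pc.s₁ pc.σ₁ = stacking L_f b_f s_f ∧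
      rigid M t '' stacking pc.L₂ pc.s₂ pc.σ₂ = stacking L_g b_g s_g ∧
      (∀ i j : ℤ, (¬ CoAx (pc.A₁ i) (pc.A₂ j) → (13 / 25 : ℝ) ≤ pc.c i j) ∧
        (CoAx (pc.A₁ i) (pc.A₂ j) → pc.A₁ i '' fccRef ≠ pc.A₂ j '' fccRef → 1 / 2 * Real.sqrt (1 - ⟪pc.m i j, e₃⟫_ℝ ^ 2) ≤ pc.c i j)) ∧
      (∀ q ∈ Finset.univ.image x, M.symm (q - t) ∈ cyl R₀ h ρ → M.symm (q - t) ∈ pc.X) := by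
  classical
  -- the two clean columns: every site in the certified cylinder is a ball
  have hclean_f := (column_clean hx hs_f L_f b_f K_f N_f hρ_f hN_f hocc_f).2
  have hclean_g := (column_clean hx hs_g L_g b_g K_g N_g hρ_g hN_g hocc_g).2
  have hX' : ∀ p ∈ Finset.univ.image x, ∀ q ∈ Finset.univ.image x, p ≠ q → 1 ≤ dist p q := image_sep hx
  -- the two window facts
  have hf : ∀ w ∈ stacking L_f b_f s_f, -(2 * R₀) ≤ (M.symm (w - t)) 2 → (M.symm (w - t)) 2 ≤ -R₀ →
      (M.symm (w - t)) 0 ^ 2 + (M.symm (w - t)) 1 ^ 2 ≤ ρ ^ 2 → w ∈ Finset.univ.image x := by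
    intro w hw h1 h2 h3
    obtain ⟨ha, hb, hc⟩ := hin_f w h1 h2 h3
    exact mem_image_univ_iff_mem_range.2 (hclean_f w hw ha hb hc)
  have hg : ∀ w ∈ stacking L_g b_g s_g, h + R₀ ≤ (M.symm (w - t)) 2 → (M.symm (w - t)) 2 ≤ h + 2 * R₀ →
      (M.symm (w - t)) 0 ^ 2 + (M.symm (w - t)) 1 ^ 2 ≤ ρ ^ 2 → w ∈ Finset.univ.image x := by
    intro w hw h1 h2 h3
    obtain ⟨ha, hb, hc⟩ := hin_g w h1 h2 h3
    exact mem_image_univ_iff_mem_range.2 (hclean_g w hw ha hb hc)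
  exact exists_placedCell_of_windows_pres C R₀ hs_f hs_g L_f L_g b_f b_g hR₀ hh hρ (Finset.univ.image x) hX' M t hf hg

end Summit.Ventures.Crystal3D.Cruxes.TextureLiminf.TexShadow

end
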